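import Mathlib
import Summits.NavierStokesRegularity.NavierStokesRegularity.Theorems.LerayQuarterDissipationFiniteDissipationLiouvilleTrappingMixedSlice
import HarnessLib

/-!
# Crux `FiniteDissipationLiouville` (stmt-NavierStokesRegularity-22144): FORWARD TRAPPING inside the
# MIXED `(C, K)` LENS — the two mechanisms of lead g17 combined (file 2/2: the theorem)

Theorems file of route `LerayQuarterDissipation` (lead prover g17; `--supports` the crux; sequel of
`…MixedRegion` and `…Trapping`). Navier–Stokes regularity is NOT proved by anything here; no summit
is.

`𝒟_{C,K}`: Type-I ancient mild fields `V` (KNSS gauge, constant `C`) with Leray's quarter-rate law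
`∫‖DV(t)‖² ≤ K/√(−t)`; `Z(s) = ∫‖Ω(s)‖²` the global similarity enstrophy (`= √(−t)∫‖ω(t)‖²dx`);
`K_S` Mathlib's Gagliardo–Nirenberg–Sobolev constant; `θ(k) = √k·(√K_S)³`.
`…Trapping` trapped the enstrophy below the number `64/27` of the pure `K`-rung by pricing each
slice by its own dissipation; `…MixedRegion` enlarged the `K`-rung to the lens
`λC²/μ + (1−λ)κ³θ(K)⁴ < 1` (weights with `2λμ + (1−λ)·3(1+δ)/(2κ) ≤ 2`). Here the slice-wise budget
is priced by the MIXED bound, so the trapped region takes the shape of the lens: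

* (file 1/2 `…TrappingMixedSlice`: the mixed slice-wise damped budget;)
* `trapping_of_sliceBudget` — the bootstrap of `…Trapping.trapping_exp` ABSTRACTED: a damped slice
  budget below a level `k > Z(s₀)` plus a crude one at the law's level give
  `Z(s) ≤ e^{−r(s−s₀)}Z(s₀)` for `s ≥ s₀`;
* **`trapping_mixed_exp`** — **if at ONE instant `s₀` the pair `(C, Z(s₀))` lies in the lens,
  `λC²/μ + (1−λ)κ³(√Z(s₀)(√K_S)³)⁴ < 1` for admissible weights, then `Z(s) ≤ e^{−r(s−s₀)}Z(s₀)` for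
  all `s ≥ s₀`** (for `C ≤ 1` the trapped region is `K_S⁶Z² < 4` instead of `64/27`).

The companion `…EveryInstantMixed` turns this into the lens-shaped every-instant floor.

HONEST FRAMING. Statements about a HYPOTHETICAL object, explicit in Mathlib's non-sharp `K_S`, rate
`r` existential. Nothing is removed from the catalogued DSS wall (`∀ c > 1, TypeIDSSLiouville c`,
NECESSARY for the crux); verdict of the line unchanged (FRONTIER). Nothing here bears on Navier–Stokes
regularity or blow-up.

References: J. Leray, Acta Math. 63 (1934) §20; Robinson–Rodrigo–Sadowski, *The three-dimensional
Navier–Stokes equations* (2016) Thm 6.12 (invariant small-enstrophy region, bounded domains);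
Koch–Nadirashvili–Seregin–Šverák, Acta Math. 203 (2009) §4; folklore energy method.
-/

noncomputable section

set_option linter.dupNamespace false

namespace Summit.NavierStokesRegularity.NavierStokesRegularity.Theorems.FiniteDissipationLiouville.TrappingMixed

open MeasureTheory Set Filter Topology Metric InnerProductSpace Function Real
open scoped RealInnerProductSpace ContDiff ENNReal Laplacian
open Literature.Analysis Literature.Analysis.FluidPDE
open Summit.NavierStokesRegularity.NavierStokesRegularity.Theorems
open Summit.NavierStokesRegularity.NavierStokesRegularity.Theorems.GaussianGap
open Summit.NavierStokesRegularity.NavierStokesRegularity.Theorems.SimilarityEnstrophy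
open Summit.NavierStokesRegularity.NavierStokesRegularity.Theorems.SmallDissipationGap
open Summit.NavierStokesRegularity.NavierStokesRegularity.Theorems.FiniteDissipationLiouville.VorticityAmplitude
open Summit.NavierStokesRegularity.NavierStokesRegularity.Theorems.FiniteDissipationLiouville.Trapping

variable {C : ℝ} {V : ℝ → (EuclideanSpace ℝ (Fin 3)) → (EuclideanSpace ℝ (Fin 3))}

/-! ### The abstract bootstrap -/

section Bootstrap

/-- **Trapping from slice budgets (the bootstrap of `…Trapping.trapping_exp`, abstracted).** Let
`V ∈ 𝒟_{C,K}`, `z₀ = Z(s₀) < k`. Suppose (damped budget below the level `k`) there are `r > 0`,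
`L ≥ 0` with `Z_R'(σ) ≤ −r Z_R(σ) + (L/R)∫_{B̄_{2R}}‖Ω(σ)‖²` for all `R ≥ 1` and all `σ` with
`Z(σ) ≤ k`, and (crude budget) `a > 0`, `L₂ ≥ 0` with `Z_R'(σ) ≤ a Z_R(σ) + (L₂/R)∫_{B̄_{2R}}‖Ω(σ)‖²`
for all `R ≥ 1`, `σ`. Then `Z(s) ≤ e^{−r(s−s₀)} z₀` for all `s ≥ s₀`. [folklore energy method] -/
theorem trapping_of_sliceBudget (hV : IsTypeIAncientMild C V) {K : ℝ}
    (hK : ∀ t : ℝ, t < 0 → ∫⁻ x, ‖fderiv ℝ (V t) x‖ₑ ^ 2 ≤ ENNReal.ofReal (K / Real.sqrt (-t)))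
    {s₀ k r L a L₂ : ℝ} (hzk : (∫ y, ‖lerayVorticity V s₀ y‖ ^ 2) < k) (hr : 0 < r) (hL0 : 0 ≤ L)
    (hdamped : ∀ R : ℝ, 1 ≤ R → ∀ σ : ℝ, (∫ y, ‖lerayVorticity V σ y‖ ^ 2) ≤ k →
      deriv (fun σ' => ∫ y, smoothTransition (2 - ‖y‖ ^ 2 / R ^ 2) ^ 2 * ‖lerayVorticity V σ' y‖ ^ 2) σ ≤
        -r * (∫ y, smoothTransition (2 - ‖y‖ ^ 2 / R ^ 2) ^ 2 * ‖lerayVorticity V σ y‖ ^ 2) +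
          L / R * ∫ y in closedBall (0 : (EuclideanSpace ℝ (Fin 3))) (2 * R), ‖lerayVorticity V σ y‖ ^ 2)
    (ha : 0 < a) (hL₂0 : 0 ≤ L₂)
    (hcrude : ∀ R : ℝ, 1 ≤ R → ∀ σ : ℝ,
      deriv (fun σ' => ∫ y, smoothTransition (2 - ‖y‖ ^ 2 / R ^ 2) ^ 2 * ‖lerayVorticity V σ' y‖ ^ 2) σ ≤
        a * (∫ y, smoothTransition (2 - ‖y‖ ^ 2 / R ^ 2) ^ 2 * ‖lerayVorticity V σ y‖ ^ 2) +
          L₂ / R * ∫ y in closedBall (0 : (EuclideanSpace ℝ (Fin 3))) (2 * R), ‖lerayVorticity V σ y‖ ^ 2) :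
    ∀ s : ℝ, s₀ ≤ s →
      ∫ y, ‖lerayVorticity V s y‖ ^ 2 ≤
        Real.exp (-r * (s - s₀)) * ∫ y, ‖lerayVorticity V s₀ y‖ ^ 2 := by
  have hΩi := fun σ => integrable_sq_norm_lerayVorticity hV hK σ
  obtain ⟨M, hM0, hZiM⟩ : ∃ M : ℝ, 0 ≤ M ∧ ∀ σ, ∫ y, ‖lerayVorticity V σ y‖ ^ 2 ≤ M :=
    ⟨‖curlCLM‖ ^ 2 * max K 0, by positivity, fun σ => (hΩi σ).2⟩
  have hZi0 : ∀ σ, 0 ≤ ∫ y, ‖lerayVorticity V σ y‖ ^ 2 := fun σ => integral_nonneg fun y => sq_nonneg _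
  obtain ⟨z₀, hz₀def⟩ : ∃ z₀ : ℝ, z₀ = ∫ y, ‖lerayVorticity V s₀ y‖ ^ 2 := ⟨_, rfl⟩
  rw [← hz₀def] at hzk ⊢
  have hz0 : 0 ≤ z₀ := hz₀def ▸ hZi0 s₀
  have hZRle : ∀ (R : ℝ) (σ : ℝ), (∫ y, smoothTransition (2 - ‖y‖ ^ 2 / R ^ 2) ^ 2 *
      ‖lerayVorticity V σ y‖ ^ 2) ≤ ∫ y, ‖lerayVorticity V σ y‖ ^ 2 := by
    intro R σ
    refine integral_mono_of_nonneg (Eventually.of_forall fun y =>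
      mul_nonneg (sq_nonneg _) (sq_nonneg _)) (hΩi σ).1 (Eventually.of_forall fun y => ?_)
    exact mul_le_of_le_one_left (sq_nonneg _) (sqCutoff_le_one R y)
  have hZR0 : ∀ (R : ℝ) (σ : ℝ), 0 ≤ ∫ y, smoothTransition (2 - ‖y‖ ^ 2 / R ^ 2) ^ 2 *
      ‖lerayVorticity V σ y‖ ^ 2 := fun R σ =>
    integral_nonneg fun y => mul_nonneg (sq_nonneg _) (sq_nonneg _)
  have hIle : ∀ (R : ℝ) (σ : ℝ), (∫ y in closedBall (0 : EuclideanSpace ℝ (Fin 3)) (2 * R),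
      ‖lerayVorticity V σ y‖ ^ 2) ≤ M := fun R σ =>
    (setIntegral_le_integral (hΩi σ).1 (Eventually.of_forall fun y => sq_nonneg _)).trans (hZiM σ)
  have hdiff : ∀ R : ℝ, 0 < R → Differentiable ℝ fun σ =>
      ∫ y, smoothTransition (2 - ‖y‖ ^ 2 / R ^ 2) ^ 2 * ‖lerayVorticity V σ y‖ ^ 2 :=
    fun R hR σ => (hasDerivAt_sqCutoffEnstrophy hV hR σ).differentiableAt
  -- STEP B
  have stepB : ∀ s₁ : ℝ, (∀ σ ∈ Icc s₀ s₁, ∫ y, ‖lerayVorticity V σ y‖ ^ 2 ≤ k) →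
      ∀ σ ∈ Icc s₀ s₁, ∫ y, ‖lerayVorticity V σ y‖ ^ 2 ≤ Real.exp (-r * (σ - s₀)) * z₀ := by
    intro s₁ hwin σ hσ
    refine integral_sq_norm_lerayVorticity_le_of_forall_nat hV hK σ (B := L * M / r) fun n hn => ?_
    have hR : 0 < (n : ℝ) := lt_of_lt_of_le one_pos hn
    have hode : ∀ σ' ∈ Icc s₀ s₁, deriv (fun σ =>
        ∫ y, smoothTransition (2 - ‖y‖ ^ 2 / (n : ℝ) ^ 2) ^ 2 * ‖lerayVorticity V σ y‖ ^ 2) σ' ≤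
        (-r) * (∫ y, smoothTransition (2 - ‖y‖ ^ 2 / (n : ℝ) ^ 2) ^ 2 * ‖lerayVorticity V σ' y‖ ^ 2) +
          L * M / n := by
      intro σ' hσ'
      have h := hdamped n hn σ' (hwin σ' hσ')
      have h2 : L / n * (∫ y in closedBall (0 : EuclideanSpace ℝ (Fin 3)) (2 * n),
          ‖lerayVorticity V σ' y‖ ^ 2) ≤ L * M / n := by
        have := mul_le_mul_of_nonneg_left (hIle n σ') (div_nonneg hL0 hR.le)
        calc _ ≤ L / n * M := this
          _ = L * M / n := by ring
      linarith
    have hcmp := le_of_deriv_le_mul_add_Icc (hdiff n hR) (neg_ne_zero.2 hr.ne') hode σ hσ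
    have hexp0 : 0 < Real.exp (-r * (σ - s₀)) := Real.exp_pos _
    have e : Real.exp (-r * (σ - s₀)) *
        ((∫ y, smoothTransition (2 - ‖y‖ ^ 2 / (n : ℝ) ^ 2) ^ 2 * ‖lerayVorticity V s₀ y‖ ^ 2) +
          L * M / ↑n / -r) - L * M / ↑n / -r =
        Real.exp (-r * (σ - s₀)) *
          (∫ y, smoothTransition (2 - ‖y‖ ^ 2 / (n : ℝ) ^ 2) ^ 2 * ‖lerayVorticity V s₀ y‖ ^ 2) +
          (1 - Real.exp (-r * (σ - s₀))) * (L * M / r / n) := by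
      field_simp
      ring
    rw [e] at hcmp
    have h4 : 0 ≤ L * M / r / n := by positivity
    have h3 : (1 - Real.exp (-r * (σ - s₀))) * (L * M / r / n) ≤ L * M / r / n := by
      nlinarith only [h4, hexp0]
    have h5 : Real.exp (-r * (σ - s₀)) *
        (∫ y, smoothTransition (2 - ‖y‖ ^ 2 / (n : ℝ) ^ 2) ^ 2 * ‖lerayVorticity V s₀ y‖ ^ 2) ≤
        Real.exp (-r * (σ - s₀)) * z₀ :=
      mul_le_mul_of_nonneg_left (hz₀def ▸ hZRle n s₀) hexp0.le
    linarith
  -- STEP C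
  obtain ⟨τ, hτpos, hτ⟩ : ∃ τ : ℝ, 0 < τ ∧ Real.exp (a * τ) * z₀ < k := by
    have hcont : ContinuousAt (fun τ : ℝ => Real.exp (a * τ) * z₀) 0 := by fun_prop
    have h00 : Real.exp (a * 0) * z₀ < k := by rw [mul_zero, Real.exp_zero, one_mul]; exact hzk
    have hev : ∀ᶠ τ in 𝓝[>] (0 : ℝ), Real.exp (a * τ) * z₀ < k :=
      nhdsWithin_le_nhds (hcont.eventually_lt continuousAt_const h00)
    obtain ⟨τ, hτ1, hτ2⟩ := (hev.and self_mem_nhdsWithin).exists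
    exact ⟨τ, hτ2, hτ1⟩
  have stepC : ∀ s₁ : ℝ, (∫ y, ‖lerayVorticity V s₁ y‖ ^ 2) ≤ z₀ →
      ∀ σ ∈ Icc s₁ (s₁ + τ), ∫ y, ‖lerayVorticity V σ y‖ ^ 2 ≤ k := by
    intro s₁ hs₁ σ hσ
    have hστ : σ - s₁ ≤ τ := by linarith [hσ.2]
    refine (integral_sq_norm_lerayVorticity_le_of_forall_nat hV hK σ
      (A := Real.exp (a * τ) * z₀) (B := Real.exp (a * τ) * (L₂ * M / a)) fun n hn => ?_).trans hτ.le
    have hR : 0 < (n : ℝ) := lt_of_lt_of_le one_pos hn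
    have hode : ∀ σ' ∈ Icc s₁ (s₁ + τ), deriv (fun σ =>
        ∫ y, smoothTransition (2 - ‖y‖ ^ 2 / (n : ℝ) ^ 2) ^ 2 * ‖lerayVorticity V σ y‖ ^ 2) σ' ≤
        a * (∫ y, smoothTransition (2 - ‖y‖ ^ 2 / (n : ℝ) ^ 2) ^ 2 * ‖lerayVorticity V σ' y‖ ^ 2) +
          L₂ * M / n := by
      intro σ' _
      have h := hcrude n hn σ'
      have h2 : L₂ / n * (∫ y in closedBall (0 : EuclideanSpace ℝ (Fin 3)) (2 * n),
          ‖lerayVorticity V σ' y‖ ^ 2) ≤ L₂ * M / n := by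
        have := mul_le_mul_of_nonneg_left (hIle n σ') (div_nonneg hL₂0 hR.le)
        calc _ ≤ L₂ / n * M := this
          _ = L₂ * M / n := by ring
      linarith
    have hcmp := le_of_deriv_le_mul_add_Icc (hdiff n hR) ha.ne' hode σ hσ
    have hb : 0 ≤ L₂ * M / n / a := by positivity
    have hexpτ : Real.exp (a * (σ - s₁)) ≤ Real.exp (a * τ) :=
      Real.exp_le_exp.2 (mul_le_mul_of_nonneg_left hστ ha.le)
    have hsum0 : 0 ≤ (∫ y, smoothTransition (2 - ‖y‖ ^ 2 / (n : ℝ) ^ 2) ^ 2 *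
        ‖lerayVorticity V s₁ y‖ ^ 2) + L₂ * M / n / a := add_nonneg (hZR0 n s₁) hb
    have hZs : (∫ y, smoothTransition (2 - ‖y‖ ^ 2 / (n : ℝ) ^ 2) ^ 2 * ‖lerayVorticity V s₁ y‖ ^ 2) +
        L₂ * M / n / a ≤ z₀ + L₂ * M / n / a := by linarith [(hZRle n s₁).trans hs₁]
    have h3 : Real.exp (a * (σ - s₁)) *
        ((∫ y, smoothTransition (2 - ‖y‖ ^ 2 / (n : ℝ) ^ 2) ^ 2 * ‖lerayVorticity V s₁ y‖ ^ 2) +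
          L₂ * M / n / a) ≤ Real.exp (a * τ) * (z₀ + L₂ * M / n / a) :=
      (mul_le_mul_of_nonneg_right hexpτ hsum0).trans (mul_le_mul_of_nonneg_left hZs
        (Real.exp_pos _).le)
    have e : Real.exp (a * τ) * (z₀ + L₂ * M / n / a) =
        Real.exp (a * τ) * z₀ + Real.exp (a * τ) * (L₂ * M / a) / n := by
      field_simp
    linarith [hcmp, h3, e.le]
  -- INDUCTION
  have hind : ∀ n : ℕ, ∀ σ ∈ Icc s₀ (s₀ + n * τ), ∫ y, ‖lerayVorticity V σ y‖ ^ 2 ≤ k := by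
    intro n
    induction n with
    | zero =>
        intro σ hσ
        simp only [Nat.cast_zero, zero_mul, add_zero] at hσ
        have : σ = s₀ := le_antisymm hσ.2 hσ.1
        rw [this, ← hz₀def]; exact hzk.le
    | succ n ih =>
        intro σ hσ
        rcases le_or_gt σ (s₀ + n * τ) with h | h
        · exact ih σ ⟨hσ.1, h⟩
        · have hnτ : 0 ≤ (n : ℝ) * τ := mul_nonneg n.cast_nonneg hτpos.le
          have hB := stepB (s₀ + n * τ) ih (s₀ + n * τ) ⟨by linarith, le_rfl⟩
          have hexp1 : Real.exp (-r * (s₀ + n * τ - s₀)) ≤ 1 := by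
            rw [Real.exp_le_one_iff, neg_mul, neg_nonpos]
            exact mul_nonneg hr.le (by linarith)
          have hz₁ : (∫ y, ‖lerayVorticity V (s₀ + n * τ) y‖ ^ 2) ≤ z₀ :=
            hB.trans (mul_le_of_le_one_left hz0 hexp1)
          refine stepC (s₀ + n * τ) hz₁ σ ⟨h.le, ?_⟩
          have := hσ.2; push_cast at this; linarith
  intro s hs
  obtain ⟨n, hn⟩ : ∃ n : ℕ, s ≤ s₀ + n * τ := by
    obtain ⟨n, hn⟩ := exists_nat_ge ((s - s₀) / τ)
    refine ⟨n, ?_⟩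
    have := (div_le_iff₀ hτpos).1 hn
    linarith
  exact stepB s (fun σ hσ => hind n σ ⟨hσ.1, hσ.2.trans hn⟩) s ⟨hs, le_rfl⟩

end Bootstrap

/-! ### Trapping inside the lens -/

section Lens

/-- **FORWARD TRAPPING INSIDE THE MIXED LENS.** Let `V ∈ 𝒟_{C,K}` and let `0 ≤ λ ≤ 1`,
`μ, κ, δ > 0` be weights with `2λμ + (1−λ)·3(1+δ)/(2κ) ≤ 2`. If at ONE instant `s₀` the global
similarity enstrophy `Z(s₀)` satisfies `λC²/μ + (1−λ)κ³·max((√Z(s₀)(√K_S)³)⁴, 1) < 1`, then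
`Z(s) ≤ e^{−r(s−s₀)}Z(s₀)` for all `s ≥ s₀`, some `r > 0`. (The `max(·,1)` is harmless on the lens,
which lies above `θ⁴ = 64/27 > 1`; for `θ⁴ ≤ 1` the pure `K`-trapping of `…Trapping` applies.)
[folklore energy method] -/
theorem trapping_mixed_exp (hV : IsTypeIAncientMild C V) {K : ℝ}
    (hK : ∀ t : ℝ, t < 0 → ∫⁻ x, ‖fderiv ℝ (V t) x‖ₑ ^ 2 ≤ ENNReal.ofReal (K / Real.sqrt (-t)))
    {s₀ lam μ κ δ : ℝ} (hlam0 : 0 ≤ lam) (hlam1 : lam ≤ 1) (hμ : 0 < μ) (hκ : 0 < κ) (hδ : 0 < δ)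
    (H1 : 2 * lam * μ + (1 - lam) * (3 * (1 + δ) / (2 * κ)) ≤ 2)
    (H2 : lam * C ^ 2 / μ + (1 - lam) * κ ^ 3 *
      (max ((Real.sqrt (∫ y, ‖lerayVorticity V s₀ y‖ ^ 2) * Real.sqrt (SNormLESNormFDerivOfEqConst (EuclideanSpace ℝ (Fin 3))
        (volume : Measure (EuclideanSpace ℝ (Fin 3))) 2 : ℝ) ^ 3) ^ 4) 1) < 1) :
    ∃ r : ℝ, 0 < r ∧ ∀ s : ℝ, s₀ ≤ s →
      ∫ y, ‖lerayVorticity V s y‖ ^ 2 ≤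
        Real.exp (-r * (s - s₀)) * ∫ y, ‖lerayVorticity V s₀ y‖ ^ 2 := by
  have hKS0 : 0 ≤ (SNormLESNormFDerivOfEqConst (EuclideanSpace ℝ (Fin 3))
        (volume : Measure (EuclideanSpace ℝ (Fin 3))) 2 : ℝ) := NNReal.coe_nonneg _
  have hDU := fun σ => integrable_sq_norm_fderiv_lerayOrbit hV hK σ
  have hDUle : ∀ σ, ∫ y, ‖fderiv ℝ (lerayOrbit V σ) y‖ ^ 2 ≤ ∫ y, ‖lerayVorticity V σ y‖ ^ 2 :=
    fun σ => VorticityAmplitude.integral_sq_norm_fderiv_lerayOrbit_le hV hK σ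
  set z₀ : ℝ := ∫ y, ‖lerayVorticity V s₀ y‖ ^ 2 with hz₀
  have hz0 : 0 ≤ z₀ := integral_nonneg fun y => sq_nonneg _
  have h1lam : 0 ≤ 1 - lam := by linarith
  -- `max(θ(k)⁴,1) = max (k²K_S⁶) 1` is continuous in the level `k`
  have hθ4 : ∀ k : ℝ, 0 ≤ k → (Real.sqrt k * Real.sqrt (SNormLESNormFDerivOfEqConst (EuclideanSpace ℝ (Fin 3))
        (volume : Measure (EuclideanSpace ℝ (Fin 3))) 2 : ℝ) ^ 3) ^ 4 = k ^ 2 * (SNormLESNormFDerivOfEqConst (EuclideanSpace ℝ (Fin 3))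
        (volume : Measure (EuclideanSpace ℝ (Fin 3))) 2 : ℝ) ^ 6 := by
    intro k hk
    rw [mul_pow, show Real.sqrt k ^ 4 = (Real.sqrt k ^ 2) ^ 2 by ring, Real.sq_sqrt hk,
      show (Real.sqrt (SNormLESNormFDerivOfEqConst (EuclideanSpace ℝ (Fin 3))
        (volume : Measure (EuclideanSpace ℝ (Fin 3))) 2 : ℝ) ^ 3) ^ 4 = (Real.sqrt (SNormLESNormFDerivOfEqConst (EuclideanSpace ℝ (Fin 3))
        (volume : Measure (EuclideanSpace ℝ (Fin 3))) 2 : ℝ) ^ 2) ^ 6 by ring, Real.sq_sqrt hKS0]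
  have hmax4 : ∀ k : ℝ, 0 ≤ k →
      (max (Real.sqrt k * Real.sqrt (SNormLESNormFDerivOfEqConst (EuclideanSpace ℝ (Fin 3))
        (volume : Measure (EuclideanSpace ℝ (Fin 3))) 2 : ℝ) ^ 3) 1) ^ 4 = max (k ^ 2 * (SNormLESNormFDerivOfEqConst (EuclideanSpace ℝ (Fin 3))
        (volume : Measure (EuclideanSpace ℝ (Fin 3))) 2 : ℝ) ^ 6) 1 := by
    intro k hk
    have h0 : 0 ≤ Real.sqrt k * Real.sqrt (SNormLESNormFDerivOfEqConst (EuclideanSpace ℝ (Fin 3))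
        (volume : Measure (EuclideanSpace ℝ (Fin 3))) 2 : ℝ) ^ 3 := by positivity
    rcases le_total (Real.sqrt k * Real.sqrt (SNormLESNormFDerivOfEqConst (EuclideanSpace ℝ (Fin 3))
        (volume : Measure (EuclideanSpace ℝ (Fin 3))) 2 : ℝ) ^ 3) 1 with h | h
    · rw [max_eq_right h]
      have : k ^ 2 * (SNormLESNormFDerivOfEqConst (EuclideanSpace ℝ (Fin 3))
        (volume : Measure (EuclideanSpace ℝ (Fin 3))) 2 : ℝ) ^ 6 ≤ 1 := by
        rw [← hθ4 k hk]; exact pow_le_one₀ h0 h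
      rw [max_eq_right this]; norm_num
    · rw [max_eq_left h]
      have : 1 ≤ k ^ 2 * (SNormLESNormFDerivOfEqConst (EuclideanSpace ℝ (Fin 3))
        (volume : Measure (EuclideanSpace ℝ (Fin 3))) 2 : ℝ) ^ 6 := by
        rw [← hθ4 k hk]; exact one_le_pow₀ h
      rw [max_eq_left this, hθ4 k hk]
  -- (1) a level `k > z₀` still inside the lens
  set F : ℝ → ℝ := fun k => lam * C ^ 2 / μ + (1 - lam) * κ ^ 3 * max (k ^ 2 * (SNormLESNormFDerivOfEqConst (EuclideanSpace ℝ (Fin 3))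
        (volume : Measure (EuclideanSpace ℝ (Fin 3))) 2 : ℝ) ^ 6) 1 with hF
  have hF0 : F z₀ < 1 := by
    have e : max ((Real.sqrt z₀ * Real.sqrt (SNormLESNormFDerivOfEqConst (EuclideanSpace ℝ (Fin 3))
        (volume : Measure (EuclideanSpace ℝ (Fin 3))) 2 : ℝ) ^ 3) ^ 4) 1 = max (z₀ ^ 2 * (SNormLESNormFDerivOfEqConst (EuclideanSpace ℝ (Fin 3))
        (volume : Measure (EuclideanSpace ℝ (Fin 3))) 2 : ℝ) ^ 6) 1 := by
      rw [hθ4 z₀ hz0]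
    rw [hF]; simpa only [e] using H2
  obtain ⟨k, hzk, hk⟩ : ∃ k : ℝ, z₀ < k ∧ F k < 1 := by
    have hcont : ContinuousAt F z₀ := by
      rw [hF]
      fun_prop
    have hev : ∀ᶠ k in 𝓝[>] z₀, F k < 1 :=
      nhdsWithin_le_nhds (hcont.eventually_lt continuousAt_const hF0)
    obtain ⟨k, hk1, hk2⟩ := (hev.and self_mem_nhdsWithin).exists
    exact ⟨k, hk2, hk1⟩
  have hk0 : 0 < k := lt_of_le_of_lt hz0 hzk
  -- (2) the damped mixed budget at the level `k`
  obtain ⟨L, hL0, hL⟩ := deriv_sqCutoffEnstrophy_le_mixed_slice hV (KU := k) hlam0 hlam1 hμ hκ hδ H1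
  set r : ℝ := 1 / 2 - (lam * C ^ 2 / (2 * μ) + (1 - lam) *
      (κ ^ 3 * (max (Real.sqrt k * Real.sqrt (SNormLESNormFDerivOfEqConst (EuclideanSpace ℝ (Fin 3))
        (volume : Measure (EuclideanSpace ℝ (Fin 3))) 2 : ℝ) ^ 3) 1) ^ 4 / 2)) with hrdef
  have hrpos : 0 < r := by
    have e : lam * C ^ 2 / (2 * μ) + (1 - lam) *
        (κ ^ 3 * (max (Real.sqrt k * Real.sqrt (SNormLESNormFDerivOfEqConst (EuclideanSpace ℝ (Fin 3))
        (volume : Measure (EuclideanSpace ℝ (Fin 3))) 2 : ℝ) ^ 3) 1) ^ 4 / 2) = F k / 2 := by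
      rw [hF, hmax4 k hk0.le]; ring
    rw [hrdef, e]; linarith
  have hdamped : ∀ R : ℝ, 1 ≤ R → ∀ σ : ℝ, (∫ y, ‖lerayVorticity V σ y‖ ^ 2) ≤ k →
      deriv (fun σ' => ∫ y, smoothTransition (2 - ‖y‖ ^ 2 / R ^ 2) ^ 2 * ‖lerayVorticity V σ' y‖ ^ 2) σ ≤
        -r * (∫ y, smoothTransition (2 - ‖y‖ ^ 2 / R ^ 2) ^ 2 * ‖lerayVorticity V σ y‖ ^ 2) +
          L / R * ∫ y in closedBall (0 : (EuclideanSpace ℝ (Fin 3))) (2 * R), ‖lerayVorticity V σ y‖ ^ 2 := by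
    intro R hR σ hσk
    have h := hL R hR σ (hDU σ).1 ((hDUle σ).trans hσk)
    have e : (lam * C ^ 2 / (2 * μ) + (1 - lam) *
        (κ ^ 3 * (max (Real.sqrt k * Real.sqrt (SNormLESNormFDerivOfEqConst (EuclideanSpace ℝ (Fin 3))
        (volume : Measure (EuclideanSpace ℝ (Fin 3))) 2 : ℝ) ^ 3) 1) ^ 4 / 2) - 1 / 2) = -r := by
      rw [hrdef]; ring
    rwa [e] at h
  -- (3) the crude budget at the law's own level
  obtain ⟨m₂, a, hm₂pos, hapos, hspend₂, hcoef₂⟩ := exists_crude_weights (max K 0)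
  obtain ⟨L₂, hL₂0, hL₂⟩ := deriv_sqCutoffEnstrophy_le_slice hV (KU := max K 0) hm₂pos one_pos hspend₂
  have hZR0 : ∀ (R : ℝ) (σ : ℝ), 0 ≤ ∫ y, smoothTransition (2 - ‖y‖ ^ 2 / R ^ 2) ^ 2 *
      ‖lerayVorticity V σ y‖ ^ 2 := fun R σ =>
    integral_nonneg fun y => mul_nonneg (sq_nonneg _) (sq_nonneg _)
  have hcrude : ∀ R : ℝ, 1 ≤ R → ∀ σ : ℝ,
      deriv (fun σ' => ∫ y, smoothTransition (2 - ‖y‖ ^ 2 / R ^ 2) ^ 2 * ‖lerayVorticity V σ' y‖ ^ 2) σ ≤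
        a * (∫ y, smoothTransition (2 - ‖y‖ ^ 2 / R ^ 2) ^ 2 * ‖lerayVorticity V σ y‖ ^ 2) +
          L₂ / R * ∫ y in closedBall (0 : (EuclideanSpace ℝ (Fin 3))) (2 * R), ‖lerayVorticity V σ y‖ ^ 2 := by
    intro R hR σ
    have h := hL₂ R hR σ (hDU σ).1 (hDU σ).2
    have h1 := mul_le_mul_of_nonneg_right hcoef₂ (hZR0 R σ)
    linarith
  exact ⟨r, hrpos, trapping_of_sliceBudget hV hK hzk hrpos hL0 hdamped hapos hL₂0 hcrude⟩

end Lens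

end Summit.NavierStokesRegularity.NavierStokesRegularity.Theorems.FiniteDissipationLiouville.TrappingMixed

end
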